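import Summits.CriticalPhenomena.PercolationContinuityZ3.Theorems.PercNearOneGluingNoHeavyQuantLawDecUsageMongeRates
import Summits.CriticalPhenomena.PercolationContinuityZ3.Theorems.PercNearOneGluingNoHeavyQuantFlowUncross
import HarnessLib

/-!
# QUANT lane R8, FULL-SGC line: the TOP-LOW CAPACITY bound — the depth-1 linear necessary condition of DEC(j′)
# (lows up to `i′` fit into the giants plus their compatible mids at the rate of `i′`)

builds on p205010 (kernel theorem, internal audit signed; external expert review pending)

Support file (`--supports stmt-CriticalPhenomena-4575`), QUANT lane seat prim-quant-census-2 (gen 63), rung R8 of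
`run/shared/lean/prim/quant/LADDER.md`.  One theorem, standard axioms, no sorries.  Census memo:
`run/shared/lean/prim/quant/prim-quant-census-2-g63/NP-STEP-G63.md` §4.

WHAT.  `deepLows_le_giants` (`…QuantDeepLowsGiants`) is the depth-0 linear consequence of DEC: lows with NO compatible mid ride on the giants,
`y·μ{≤ i′} ≤ (1−y)·μ{> i}` for `i + i′ < T`.  This file is the depth-1 member of the same family: for ANY low threshold `i′ ≤ j′` (`2i′ < T`) the lows
`l ≤ i′` of a flow witness at `(x, T, j′)` can only use the giants `h > j′` (rate `u = x/(1−x)`) and the mids `h ≤ j′` with `T < i′ + h`, and on such a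
mid every `l ≤ i′` pays at least the rate of `i′` (`usage` is antitone in the low, `usage_anti_low`); hence
      **`u·Σ_{l ≤ i′} μ l ≤ Σ_{h > j′} μ h + u·Σ_{h ≤ j′, T < i′+h} μ h / usage(i′, h)`**   (TLCR(j′, i′)).
For `i′` deep (`i′ + j′ < T`) the mid sum is empty and this is the two-layer bound; for `i′ =` the top low it is the exact giant test of the NP branch of
the FULL-SGC construction whenever the greedy's threshold is the top low (memo §4 (B): 59–85 % of NP layers; there `G ⟺ TLCR(j, t_top)`), and
{TLCR(j′, i′)}_{i′} is a one-parameter LINEAR family of inequalities every DEC law satisfies (census: 36 547 (law, layer, i′) triples, 0 violations).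
The product version ('the gated convolution of admissible laws satisfies every TLCR') is the proposed depth-1 companion of arm-2 g34's
`gateConv_tail_ge_dominant` (memo §4).

* `LawDec.IsFlowAtT.lowMass_le_giants_add_midCapacity` — the bound above, from a flow witness (no sign / mean / top-affordability hypotheses on `μ` needed).

[this work]; rates / flow normal form / Monge: this lane (typer g22/g25, lead g21).  Nothing here is cited as a published result.  The gluing rows served
[cite: KozmaNitzan2024, Conjecture 3 (p. 15)]; product measure [cite: Grimmett1999, §1.3 p. 10].
-/

noncomputable section

namespace Summit.CriticalPhenomena.PercolationContinuityZ3.Theorems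

namespace Quant

open Finset

namespace LawDec

/-- **TOP-LOW CAPACITY BOUND (depth-1 necessary condition of DEC(j′)).**  `f` a flow witness of `μ` at `(x, T, j′)` on `{0..M}`, `0 < x < 1`,
a threshold `i′ ≤ j′` with `2i′ < T`.  Then
`x/(1−x)·Σ_{l ≤ i′} μ l ≤ Σ_{h ≤ M, h > j′} μ h + x/(1−x)·Σ_{h ≤ M, h ≤ j′, T < i′ + h} μ h / usage x T j′ i′ h`:
every low `l ≤ i′` ships only to giants (rate `x/(1−x)`, total load `≤` the giant mass) or to mids `h` with `T < l + h ≤ i′ + h`, where it pays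
`usage(l,h) ≥ usage(i′,h) > 0`, so the mass it places on `h` is at most `(its load)/usage(i′,h)`, and the loads add up to `≤ μ h`. [this work] -/
theorem IsFlowAtT.lowMass_le_giants_add_midCapacity {x T : ℝ} {j' M : ℕ} {μ : ℕ → ℝ} {f : ℕ → ℕ → ℝ}
    (hF : IsFlowAtT x T j' M μ f) (hx0 : 0 < x) (hx1 : x < 1) (i' : ℕ) (hi' : i' ≤ j')
    (hlow : 2 * (i' : ℝ) < T) :
    x / (1 - x) * ∑ l ∈ Finset.range (i' + 1), μ l
      ≤ ∑ h ∈ Finset.range (M + 1), (if j' + 1 ≤ h then μ h else 0)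
        + x / (1 - x) * ∑ h ∈ Finset.range (M + 1),
            (if h ≤ j' ∧ T < (i' : ℝ) + h then μ h / usage x T j' i' h else 0) := by
  classical
  obtain ⟨hf0, hsupp, hrow, hcol⟩ := hF
  have h1x : 0 < 1 - x := by linarith
  have hu0 : 0 ≤ x / (1 - x) := div_nonneg hx0.le h1x.le
  -- every `l ≤ i′` is a low of layer `j′`
  have hlowl : ∀ l, l < i' + 1 → l ≤ j' ∧ 2 * (l : ℝ) < T := by
    intro l hl
    have hli : l ≤ i' := Nat.lt_succ_iff.1 hl
    refine ⟨hli.trans hi', ?_⟩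
    have : (l : ℝ) ≤ i' := by exact_mod_cast hli
    linarith
  -- `usage · h · f` terms are nonnegative
  have huf0 : ∀ l h, 0 ≤ usage x T j' l h * f l h := by
    intro l h
    rcases (hf0 l h).eq_or_lt with hz | hpos
    · rw [← hz, mul_zero]
    · obtain ⟨_, hl2, _, habs⟩ := hsupp l h hpos
      have hlh : l < h := by
        rcases habs with hg | hm
        · have := (hsupp l h hpos).1; omega
        · have : (l : ℝ) < h := by linarith
          exact_mod_cast this
      exact mul_nonneg (usage_pos_of_compat x T j' l h hx0 hx1 hl2 hlh habs).le hpos.le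
  -- rewrite the low mass as flow
  have hmass : ∑ l ∈ Finset.range (i' + 1), μ l
      = ∑ h ∈ Finset.range (M + 1), ∑ l ∈ Finset.range (i' + 1), f l h := by
    rw [Finset.sum_comm]
    refine Finset.sum_congr rfl fun l hl => ?_
    rw [Finset.mem_range] at hl
    exact (hrow l (hlowl l hl).1 (hlowl l hl).2).symm
  rw [hmass, Finset.mul_sum, Finset.mul_sum, ← Finset.sum_add_distrib]
  refine Finset.sum_le_sum fun h hh => ?_
  rw [Finset.mem_range] at hh
  have hhM : h ≤ M := by omega
  by_cases hg : j' + 1 ≤ h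
  · -- giant column: rate x/(1-x) for every low, load ≤ μ h
    have hjh : ¬ (h ≤ j' ∧ T < (i' : ℝ) + h) := fun hc => by omega
    rw [if_pos hg, if_neg hjh, mul_zero, add_zero]
    have hc := hcol h hhM (Or.inl hg)
    have hu : ∀ l ∈ Finset.range (j' + 1), usage x T j' l h * f l h = x / (1 - x) * f l h :=
      fun l _ => by rw [usage_giant_eq _ _ _ _ _ hg]
    rw [Finset.sum_congr rfl hu, ← Finset.mul_sum] at hc
    have hsub : ∑ l ∈ Finset.range (i' + 1), f l h ≤ ∑ l ∈ Finset.range (j' + 1), f l h :=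
      Finset.sum_le_sum_of_subset_of_nonneg (Finset.range_mono (by omega)) (fun l _ _ => hf0 l h)
    exact (mul_le_mul_of_nonneg_left hsub hu0).trans hc
  · rw [if_neg hg, zero_add]
    have hhj : h ≤ j' := by omega
    by_cases hcomp : T < (i' : ℝ) + h
    · -- compatible mid column
      rw [if_pos ⟨hhj, hcomp⟩]
      refine mul_le_mul_of_nonneg_left ?_ hu0
      have hmid : T ≤ 2 * (h : ℝ) := by linarith
      have hih : i' < h := by
        have : (i' : ℝ) < h := by linarith
        exact_mod_cast this
      have hupos : 0 < usage x T j' i' h := usage_pos_of_compat x T j' i' h hx0 hx1 hlow hih (Or.inr hcomp)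
      rw [le_div_iff₀ hupos]
      -- Σ_{l ≤ i'} f l h · usage(i',h) ≤ Σ_{l ≤ i'} usage(l,h) f l h ≤ Σ_{l ≤ j'} usage(l,h) f l h ≤ μ h
      have hstep : ∀ l ∈ Finset.range (i' + 1), f l h * usage x T j' i' h ≤ usage x T j' l h * f l h := by
        intro l hl
        rw [Finset.mem_range] at hl
        rcases (hf0 l h).eq_or_lt with hz | hpos
        · rw [← hz, zero_mul, mul_zero]
        · rw [mul_comm]
          refine mul_le_mul_of_nonneg_right ?_ hpos.le
          rcases (Nat.lt_succ_iff.1 hl).eq_or_lt with heq | hlt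
          · rw [heq]
          · obtain ⟨_, _, _, habs⟩ := hsupp l h hpos
            have hcl : T < (l : ℝ) + h := by
              rcases habs with hg' | hm
              · exact absurd hg' hg
              · exact hm
            exact usage_anti_low x T j' l i' h hx0 hx1 hlt hlow hcl (Or.inr hmid)
      calc (∑ l ∈ Finset.range (i' + 1), f l h) * usage x T j' i' h
          = ∑ l ∈ Finset.range (i' + 1), f l h * usage x T j' i' h := Finset.sum_mul _ _ _
        _ ≤ ∑ l ∈ Finset.range (i' + 1), usage x T j' l h * f l h := Finset.sum_le_sum hstep
        _ ≤ ∑ l ∈ Finset.range (j' + 1), usage x T j' l h * f l h :=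
            Finset.sum_le_sum_of_subset_of_nonneg (Finset.range_mono (by omega)) (fun l _ _ => huf0 l h)
        _ ≤ μ h := hcol h hhM (Or.inr hmid)
    · -- incompatible non-giant column: no low `l ≤ i'` uses it
      rw [if_neg (fun hc => hcomp hc.2), mul_zero]
      have hz : ∑ l ∈ Finset.range (i' + 1), f l h = 0 := by
        refine Finset.sum_eq_zero fun l hl => ?_
        rw [Finset.mem_range] at hl
        rcases (hf0 l h).eq_or_lt with hz | hpos
        · exact hz.symm
        · obtain ⟨_, _, _, habs⟩ := hsupp l h hpos
          rcases habs with hg' | hm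
          · exact absurd hg' hg
          · have : (l : ℝ) ≤ i' := by exact_mod_cast Nat.lt_succ_iff.1 hl
            exact absurd (by linarith) hcomp
      rw [hz, mul_zero]

end LawDec

end Quant

end Summit.CriticalPhenomena.PercolationContinuityZ3.Theorems
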